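/-
Copyright (c) 2026. All rights reserved.
Released under Apache 2.0 license as described in the file LICENSE.
Authors: abc-iut cell, campaign-S prover seat abc-iut-S1 (wave 1).
-/
import Mathlib.RingTheory.RootsOfUnity.Basic
import Mathlib.Algebra.GroupWithZero.Units.Fintype
import Mathlib.FieldTheory.Finite.Basic
import Literature.IUT.LogVolume.UnitLogKernel
import Literature.IUT.LogVolume.RamificationInvariants
import HarnessLib

/-!
# Teichmüller representatives: `K` contains exactly `p^f − 1` roots of unity of order prime to `p`

Input for "`R^μ_i ⊆ R^×_i` the torsion subgroup … the order of `R^μ_i` is equal to `p^{m_i}·(p^{f_i} − 1)`"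
([IUTchIV] Prop. 1.4, kurims p. 13).  For `K` in the cell's norm-side MLF setting (proper), `q = p^f` the
residue cardinality (`RamificationInvariants.card_residueField`):

* `isPrincipal_pow_residueCard_sub_one` — `u^{q−1} ∈ 1 + 𝔪` for every unit `u` (Fermat in `𝒪/𝔪`);
* `exists_teichmuller` — **every unit `u` is congruent mod `𝔪` to a `(q−1)`-th root of unity**
  `ω = lim u^{qⁿ}` (the Teichmüller representative; Cauchy by `‖1 − y^{pᴺ}‖ ≤ cᴺ‖1 − y‖` of
  `UnitLogKernel.lean`);
* `eq_one_of_pow_eq_one_of_not_dvd` — a root of unity of order prime to `p` in `1 + 𝔪` is `1`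
  (`1 − ζⁿ = (1 − ζ)(1 + ζ + ⋯ + ζ^{n−1})`, the second factor `≡ n` is a unit);
* `card_rootsOfUnity_residueCard_sub_one` — **`#μ_{q−1}(K) = q − 1`** (reduction mod `𝔪` is a
  bijection `μ_{q−1}(K) → (𝒪/𝔪)^×`).

Classical (Serre, *Local Fields*, Ch. II §4 Prop. 8; Neukirch ANT II (5.3)); nothing disputed.  The
`p`-primary part `p^{m}` of `R^μ` is a separate file.
-/

noncomputable section

open Filter Metric Set Finset IsLocalRing
open _root_.Topology
open IsUltrametricDist
open scoped NormedField

namespace Literature.IUT.LogVolume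

open Literature.NumberTheory.Transcendental Literature.NumberTheory.GaloisRepresentations.Ultrametric

variable (p : ℕ) [Fact p.Prime]
variable (K : Type*) [NontriviallyNormedField K] [instK : NormedAlgebra ℚ_[p] K] [IsUltrametricDist K]
  [ProperSpace K]
include instK

/-! ## Powers of principal units; Fermat in the residue field -/

omit instK [ProperSpace K] in
/-- `‖1 − ζⁿ‖ ≤ ‖1 − ζ‖` for `‖ζ‖ ≤ 1` (`1 − ζⁿ = (Σ_{i<n} ζⁱ)(1 − ζ)`, the sum has norm `≤ 1`).
[cite: NeukirchANT1999, Ch. II (5.3)] -/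
theorem norm_one_sub_pow_le {ζ : K} (hζ : ‖ζ‖ ≤ 1) (n : ℕ) : ‖1 - ζ ^ n‖ ≤ ‖1 - ζ‖ := by
  rw [← geom_sum_mul_neg ζ n, norm_mul]
  have hs : ‖∑ i ∈ range n, ζ ^ i‖ ≤ 1 :=
    IsUltrametricDist.norm_sum_le_of_forall_le_of_nonneg zero_le_one fun i _ ↦ by
      rw [norm_pow]; exact pow_le_one₀ (norm_nonneg _) hζ
  calc ‖∑ i ∈ range n, ζ ^ i‖ * ‖1 - ζ‖ ≤ 1 * ‖1 - ζ‖ := by gcongr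
    _ = ‖1 - ζ‖ := one_mul _

/-- **Fermat in the residue field**: for a unit `u`, `u^{q−1}` is a principal unit, `q = p^f = #(𝒪/𝔪)`.
[cite: NeukirchANT1999, Ch. II (5.3)] -/
theorem isPrincipal_pow_residueCard_sub_one {u : K} (hu : ‖u‖ = 1) :
    IsPrincipal (u ^ (p ^ residueDegree p K - 1)) := by
  haveI : Finite (ResidueField (Valued.integer K)) := finite_residueField
  letI : Fintype (ResidueField (Valued.integer K)) := Fintype.ofFinite _
  set U : Valued.integer K := ⟨u, Valued.integer.mem_iff.mpr hu.le⟩ with hU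
  have hUres : residue (Valued.integer K) U ≠ 0 := by
    rw [Ne, residue_eq_zero_iff, mem_maximalIdeal_iff_norm_lt_one, not_lt]
    exact hu.symm.le
  have hq : Fintype.card (ResidueField (Valued.integer K)) = p ^ residueDegree p K := by
    rw [Fintype.card_eq_nat_card, card_residueField p K]
  have hferm := FiniteField.pow_card_sub_one_eq_one (residue (Valued.integer K) U) hUres
  rw [hq, ← map_pow] at hferm
  -- `U^(q-1) - 1 ∈ 𝔪`
  have hmem : U ^ (p ^ residueDegree p K - 1) - 1 ∈ maximalIdeal (Valued.integer K) := by
    rw [← residue_eq_zero_iff, map_sub, hferm, map_one, sub_self]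
  rw [mem_maximalIdeal_iff_norm_lt_one] at hmem
  change ‖1 - u ^ (p ^ residueDegree p K - 1)‖ < 1
  rw [norm_sub_rev]
  have : ((U ^ (p ^ residueDegree p K - 1) - 1 : Valued.integer K) : K) =
      u ^ (p ^ residueDegree p K - 1) - 1 := by simp [hU]
  rw [← this]
  exact hmem

/-! ## The Teichmüller representative `ω(u) = lim u^{qⁿ}` -/

/-- **Teichmüller representatives**: every unit `u` is congruent modulo `𝔪` to a `(q−1)`-th root of
unity: `∃ ω, ω^{q−1} = 1 ∧ ‖ω − u‖ < 1` (`ω = lim_n u^{qⁿ}`, a Cauchy sequence because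
`u^{q^{n+1}} = u^{qⁿ}·(u^{q−1})^{qⁿ}` and `(u^{q−1})^{p^N} → 1` geometrically).
[cite: NeukirchANT1999, Ch. II (5.3)] -/
theorem exists_teichmuller {u : K} (hu : ‖u‖ = 1) :
    ∃ ω : K, ω ^ (p ^ residueDegree p K - 1) = 1 ∧ ‖ω - u‖ < 1 := by
  have hp : p.Prime := Fact.out
  have hyP : IsPrincipal (u ^ (p ^ residueDegree p K - 1)) := isPrincipal_pow_residueCard_sub_one p K hu
  -- freeze `Q = q = p^f`
  obtain ⟨Q, hQ⟩ : ∃ Q : ℕ, p ^ residueDegree p K = Q := ⟨_, rfl⟩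
  have hf0 : 0 < residueDegree p K := residueDegree_pos p K
  have hQ1 : 1 ≤ Q := by rw [← hQ]; exact Nat.one_le_pow _ _ hp.pos
  have hQn : ∀ n : ℕ, Q ^ n = p ^ (residueDegree p K * n) := fun n ↦ by rw [← hQ, pow_mul]
  rw [hQ] at hyP ⊢
  set y := u ^ (Q - 1) with hy
  have hy1 : ‖1 - y‖ ≤ 1 := le_of_lt hyP
  -- contraction constant
  set c := max ‖(p : K)‖ (‖1 - y‖ ^ (p - 1)) with hc
  have hc0 : 0 ≤ c := le_max_of_le_left (norm_nonneg _)
  have hc1 : c < 1 := max_lt (IwasawaLog.norm_prime_lt_one (p := p) (F := K))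
    (pow_lt_one₀ (norm_nonneg _) hyP (by have := hp.two_le; omega))
  set r := c ^ residueDegree p K with hr
  have hr0 : 0 ≤ r := pow_nonneg hc0 _
  have hr1 : r < 1 := pow_lt_one₀ hc0 hc1 hf0.ne'
  -- the key estimate `‖1 - y^(Q^n)‖ ≤ r^n ‖1 - y‖`
  have hkey : ∀ n : ℕ, ‖1 - y ^ (Q ^ n)‖ ≤ r ^ n * ‖1 - y‖ := by
    intro n
    have h := norm_one_sub_pow_prime_pow_le p K hy1 (residueDegree p K * n)
    rw [← hQn, pow_mul] at h
    exact h
  -- the sequence `t n = u^(Q^n)` and its increments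
  set t : ℕ → K := fun n ↦ u ^ (Q ^ n) with ht
  have hun : ∀ n, ‖t n‖ = 1 := fun n ↦ by rw [ht]; dsimp only; rw [norm_pow, hu, one_pow]
  have hstep : ∀ n, t (n + 1) = t n * y ^ (Q ^ n) := by
    intro n
    rw [ht, hy]
    dsimp only
    rw [← pow_mul, ← pow_add]
    congr 1
    zify [hQ1]
    ring
  have hdist : ∀ n, dist (t n) (t (n + 1)) ≤ ‖1 - y‖ * r ^ n := by
    intro n
    rw [dist_eq_norm, hstep, show t n - t n * y ^ (Q ^ n) = t n * (1 - y ^ (Q ^ n)) by ring,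
      norm_mul, hun, one_mul, mul_comm]
    exact hkey n
  have hcauchy : CauchySeq t := cauchySeq_of_le_geometric r ‖1 - y‖ hr1 hdist
  obtain ⟨ω, hω⟩ := cauchySeq_tendsto_of_complete hcauchy
  refine ⟨ω, ?_, ?_⟩
  · -- `t n ^ (Q-1) = y^(Q^n) → 1` and `→ ω^(Q-1)`
    have hpow : ∀ n, t n ^ (Q - 1) = y ^ (Q ^ n) := by
      intro n
      rw [ht, hy]
      dsimp only
      rw [← pow_mul, ← pow_mul, mul_comm]
    have h1 : Tendsto (fun n ↦ t n ^ (Q - 1)) atTop (𝓝 (ω ^ (Q - 1))) :=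
      ((continuous_pow (Q - 1)).tendsto ω).comp hω
    have h2 : Tendsto (fun n ↦ t n ^ (Q - 1)) atTop (𝓝 1) := by
      rw [tendsto_iff_norm_sub_tendsto_zero]
      have hg : Tendsto (fun n : ℕ ↦ r ^ n * ‖1 - y‖) atTop (𝓝 0) := by
        have h := (tendsto_pow_atTop_nhds_zero_of_lt_one hr0 hr1).mul_const ‖1 - y‖
        rwa [zero_mul] at h
      refine squeeze_zero (fun n ↦ norm_nonneg _) (fun n ↦ ?_) hg
      rw [hpow, norm_sub_rev]
      exact hkey n
    exact tendsto_nhds_unique h1 h2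
  · -- `‖t n - u‖ ≤ ‖1 - y‖ < 1` for all `n`, hence for the limit
    have hbound : ∀ n, ‖t n - u‖ ≤ ‖1 - y‖ := by
      intro n
      induction n with
      | zero => simp [ht]
      | succ n ih =>
        have hinc : ‖t (n + 1) - t n‖ ≤ ‖1 - y‖ := by
          rw [← dist_eq_norm, dist_comm]
          refine (hdist n).trans ?_
          calc ‖1 - y‖ * r ^ n ≤ ‖1 - y‖ * 1 := by gcongr; exact pow_le_one₀ hr0 hr1.le
            _ = ‖1 - y‖ := mul_one _
        rw [show t (n + 1) - u = (t (n + 1) - t n) + (t n - u) by ring]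
        exact (norm_add_le_max _ _).trans (max_le hinc ih)
    have hlim : Tendsto (fun n ↦ ‖t n - u‖) atTop (𝓝 ‖ω - u‖) :=
      ((continuous_id.sub continuous_const).norm.tendsto ω).comp hω
    exact (le_of_tendsto' hlim hbound).trans_lt hyP

/-! ## Roots of unity of order prime to `p` are separated modulo `𝔪` -/

omit [ProperSpace K] in
/-- **A root of unity of order prime to `p` lying in `1 + 𝔪` is trivial**: `ζⁿ = 1`, `p ∤ n`,
`‖1 − ζ‖ < 1 ⇒ ζ = 1` (`0 = 1 − ζⁿ = (Σ ζⁱ)(1 − ζ)` and `‖Σ_{i<n} ζⁱ − n‖ < 1 = ‖n‖`).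
[cite: NeukirchANT1999, Ch. II (5.3)] -/
theorem eq_one_of_pow_eq_one_of_not_dvd {ζ : K} {n : ℕ} (hpn : ¬ p ∣ n) (hζ : ζ ^ n = 1)
    (h1 : ‖1 - ζ‖ < 1) : ζ = 1 := by
  have hζ1 : ‖ζ‖ = 1 := IsPrincipal.norm_eq_one h1
  -- the geometric sum is a unit: `‖S - n‖ < 1` and `‖n‖ = 1`
  set S := ∑ i ∈ range n, ζ ^ i with hS
  have hSn : ‖S - n‖ < 1 := by
    have : S - n = ∑ i ∈ range n, (ζ ^ i - 1) := by
      rw [Finset.sum_sub_distrib, Finset.sum_const, Finset.card_range, nsmul_eq_mul, mul_one]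
    rw [this]
    refine lt_of_le_of_lt (IsUltrametricDist.norm_sum_le_of_forall_le_of_nonneg (norm_nonneg (1 - ζ))
      fun i _ ↦ ?_) h1
    rw [norm_sub_rev]
    exact norm_one_sub_pow_le K hζ1.le i
  have hnK : ‖(n : K)‖ = 1 := by
    rw [IwasawaLog.norm_natCast p (F := K) n, Padic.norm_natCast_eq_one_iff]
    exact (Nat.Prime.coprime_iff_not_dvd Fact.out).mpr hpn
  have hS0 : S ≠ 0 := by
    intro h0
    rw [h0, zero_sub, norm_neg, hnK] at hSn
    exact lt_irrefl _ hSn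
  have hprod : S * (1 - ζ) = 0 := by rw [hS, geom_sum_mul_neg, hζ, sub_self]
  rcases mul_eq_zero.mp hprod with h | h
  · exact absurd h hS0
  · exact (sub_eq_zero.mp h).symm

/-! ## Counting: `#μ_{q−1}(K) = q − 1` -/

/-- `q − 1 ≠ 0`. [cite: NeukirchANT1999, Ch. II (5.3)] -/
theorem residueCard_sub_one_ne_zero : p ^ residueDegree p K - 1 ≠ 0 := by
  have h2 : 2 ≤ p ^ residueDegree p K := by
    calc 2 ≤ p := (Fact.out : p.Prime).two_le
      _ = p ^ 1 := (pow_one p).symm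
      _ ≤ p ^ residueDegree p K := Nat.pow_le_pow_right (Fact.out : p.Prime).pos (residueDegree_pos p K)
  omega

/-- `p ∤ q − 1`. [cite: NeukirchANT1999, Ch. II (5.3)] -/
theorem not_dvd_residueCard_sub_one : ¬ p ∣ p ^ residueDegree p K - 1 := by
  have hp : p.Prime := Fact.out
  have hf := residueDegree_pos p K
  intro h
  have hdvd : p ∣ p ^ residueDegree p K := dvd_pow_self p hf.ne'
  have h1 : p ∣ p ^ residueDegree p K - (p ^ residueDegree p K - 1) := Nat.dvd_sub hdvd h
  have hq1 : 1 ≤ p ^ residueDegree p K := Nat.one_le_pow _ _ hp.pos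
  rw [Nat.sub_sub_self hq1] at h1
  exact hp.one_lt.ne' (Nat.dvd_one.mp h1)

/-- **`#μ_{q−1}(K) = q − 1`**: `K` contains exactly `q − 1` roots of unity of order dividing `q − 1`
(reduction modulo `𝔪` is a bijection onto `(𝒪/𝔪)^×`: injective by `eq_one_of_pow_eq_one_of_not_dvd`,
surjective by `exists_teichmuller`). [cite: NeukirchANT1999, Ch. II (5.3)] -/
theorem card_rootsOfUnity_residueCard_sub_one :
    Nat.card (rootsOfUnity (p ^ residueDegree p K - 1) K) = p ^ residueDegree p K - 1 := by
  classical
  haveI : NeZero (p ^ residueDegree p K - 1) := ⟨residueCard_sub_one_ne_zero p K⟩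
  haveI : Finite (ResidueField (Valued.integer K)) := finite_residueField
  set q := p ^ residueDegree p K with hq
  refine le_antisymm (card_rootsOfUnity _ _) ?_
  -- an injection `(𝒪/𝔪)^× → μ_{q-1}(K)` via Teichmüller representatives
  have hlift : ∀ c : (ResidueField (Valued.integer K))ˣ,
      ∃ ω : rootsOfUnity (q - 1) K, ∃ hω : ‖((ω : Kˣ) : K)‖ ≤ 1,
        residue (Valued.integer K) ⟨((ω : Kˣ) : K), Valued.integer.mem_iff.mpr hω⟩ = c := by
    intro c
    obtain ⟨U, hU⟩ := Ideal.Quotient.mk_surjective (c : ResidueField (Valued.integer K))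
    have hUn : ‖(U : K)‖ = 1 := by
      refine le_antisymm (Valued.integer.norm_le_one U) (not_lt.mp fun hlt ↦ c.ne_zero ?_)
      rw [← hU]
      exact (residue_eq_zero_iff _).mpr ((mem_maximalIdeal_iff_norm_lt_one U).mpr hlt)
    obtain ⟨ω, hω, hωU⟩ := exists_teichmuller p K hUn
    have hω1 : ‖ω‖ = 1 := by
      have h0 : q - 1 ≠ 0 := residueCard_sub_one_ne_zero p K
      have : ‖ω‖ ^ (q - 1) = 1 := by rw [← norm_pow, hω, norm_one]
      exact (pow_eq_one_iff_of_nonneg (norm_nonneg ω) h0).mp this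
    refine ⟨rootsOfUnity.mkOfPowEq ω hω, hω1.le, ?_⟩
    rw [← hU]
    change residue (Valued.integer K) ⟨ω, _⟩ = residue (Valued.integer K) U
    rw [← sub_eq_zero, ← map_sub, residue_eq_zero_iff, mem_maximalIdeal_iff_norm_lt_one]
    exact hωU
  choose g hg1 hg2 using hlift
  have hinj : Function.Injective g := by
    intro c c' h
    apply Units.ext
    have e1 := hg2 c
    have e2 := hg2 c'
    have hsub : (⟨((g c : Kˣ) : K), Valued.integer.mem_iff.mpr (hg1 c)⟩ : Valued.integer K) =
        ⟨((g c' : Kˣ) : K), Valued.integer.mem_iff.mpr (hg1 c')⟩ :=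
      Subtype.ext (congrArg (fun x : ↥(rootsOfUnity (q - 1) K) ↦ ((x : Kˣ) : K)) h)
    rw [hsub] at e1
    rw [← e1, ← e2]
  calc q - 1 = Nat.card (ResidueField (Valued.integer K))ˣ := by
        rw [Nat.card_units, card_residueField p K]
    _ ≤ Nat.card (rootsOfUnity (q - 1) K) := Nat.card_le_card_of_injective g hinj

end Literature.IUT.LogVolume

end
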